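import Literature.MathematicalPhysics.QuantumFieldTheory.Balaban1983to89.B12Momentum511

/-!
# `Balaban1983to89.B12Eq531Symmetry` — T. Bałaban, *Renormalization group approach to lattice gauge field theories. I*,
Commun. Math. Phys. **109** (1987) 249–301 [Balaban1987RG1]: the permutation symmetry (5.31) of the derivatives of the
functions `g_{μν}(z)` and (5.32) of the Taylor coefficients `a_{μν,κ}`, `b_{μν,κλ}` of (5.30) at `z = 1` («all the
coefficients a_{μνκ} with three different indices are equal, similarly all the coefficients a_{μμν} with μ ≠ ν are equal»),
pp. 295–296 — PROVED from the permutation covariance (5.27)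

statement-level skeleton of published theorems with citation tags; proofs where landed; nothing here is a claim about the Yang–Mills mass gap

PDF held: `paper:balaban1987-cmp109-rg-i-small-field` (journal page = PDF page + 248; pp. 295–296 [PDF 47–48] read as images from the
page renders `b2b-balaban-ref1/pages/1987-cmp109-rg-I-small-field/…-p047-x2.png`, `…-p048-x2.png`).

CITATION HEADER / WHAT IS REPRODUCED.  SKELETON row `B12.Eq5.30-5.32` of the cell `lit-balaban` (HOME
`run/shared/lean/pub/lit-balaban/`, reader file `lit-balaban-r09/ROWS-B12.md`), so far `typed-existing` with «(5.31)–(5.32):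
implicit in the symmetric carriers» (the jet algebra `B12Sec5Algebra.T2` takes the equalities of (5.32) as the SHAPE of its
data).  This file proves (5.31) and (5.32) AS PRINTED for an arbitrary family `g_{μν}` of functions on `ℂ^d` with the
covariance (5.27), in particular for the paper's `g_{μν}` = `B12Rep526Coeff.gRep` (whose (5.27) is `B12Rep526Coeff.eq527`,
from (5.12)) and for `f_{μν}` = (5.29) (whose (5.18) is `B12Rep526Coeff.eq518`); the derivatives are the complex partial
derivatives `B12Momentum511.pderiv`.  Unit `lit-balaban-r09` gen 5.  The Taylor FORMULA (5.30) itself (integral remainder)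
is not restated here (jets: `B12Sec5Algebra`).

WHAT IS PRINTED (pp. 295–296, verbatim).  (5.27): *"g_{μν}(rz) = ((r⊗r)g)_{μν}(z) if r is a permutation."*  (5.30):
*"g_{μν}(z) = g_{μν}(1) + Σ_κ(z_κ − 1)(∂/∂z_κ g_{μν})(1) + ½Σ_{κ,λ}(z_κ − 1)(z_λ − 1)(∂²/∂z_κ∂z_λ g_{μν})(1) + … = g_{μν}(1) +
Σ_κ a_{μν,κ}(z_κ − 1) + ½Σ_{κ,λ} b_{μν,κλ}(z_κ − 1)(z_λ − 1) + Σ_{κ,λ,ρ} g_{μν,κλρ}(z)(z_κ − 1)(z_λ − 1)(z_ρ − 1)."*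
*"Let us investigate the coefficients. The properties (5.27) imply
(∂/∂z_ρ g_{μν})(z) = Σ_{κ,λ,σ} r_{μκ}r_{νλ}r_{ρσ}(∂/∂z_σ g_{κλ})(r⁻¹z)  (5.31)
for all permutations r, identically for higher order derivatives, hence
a_{μν,ρ} = Σ r_{μκ}r_{νλ}r_{ρσ}a_{κλ,σ},  the same for b_{μν,κλ}.  (5.32)
This implies that all the coefficients a_{μνκ} with three different indices are equal, similarly all the coefficients
a_{μμν} with μ ≠ ν are equal, and so on. The same conclusions hold for b_{μνκλ}."*
READING.  With `(rz)_μ = z_{r⁻¹μ}` (`B12Rep526.permZ`, the reading of (5.18)/(5.27) in the tree) the permutation matrix is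
`r_{μκ} = δ_{μ, rκ}`, so `Σ_{κ,λ,σ} r_{μκ}r_{νλ}r_{ρσ}F_{κλ,σ} = F_{r⁻¹μ r⁻¹ν, r⁻¹ρ}`; (5.31) reads
`(∂_ρg_{μν})(z) = (∂_{r⁻¹ρ}g_{r⁻¹μ r⁻¹ν})(r⁻¹z)` and (5.32) `a_{μν,ρ} = a_{r⁻¹μ r⁻¹ν, r⁻¹ρ}`, `b_{μν,κλ} = b_{r⁻¹μ r⁻¹ν, r⁻¹κ r⁻¹λ}`.

WHAT IS PROVED (kernel-checked; any `d`; `g : Fin d → Fin d → (ℂ^d → ℂ)` any family with `Cov527 g`; no analytic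
hypothesis is needed — (5.31) is an identity between one-variable difference quotients along coordinate lines).
* §1 `Cov527` (= (5.27) for a family), the line bookkeeping `permZ_add_smul_single`, and the core lemma `pderiv_of_permCov`.
* §2 **(5.31)** `eq531` (first derivatives, every `z`), «identically for higher order derivatives»: `eq531_order2`,
  `eq531_order3`.
* §3 **(5.32)** for `a_{μν,ρ} = (∂g_{μν}/∂z_ρ)(1)` (`coeffA`) and `b_{μν,κλ} = (∂²g_{μν}/∂z_κ∂z_λ)(1)` (`coeffB`): `eq532_a`,
  `eq532_b`; and the printed consequences **`coeffA_eq_of_distinct`** («all the coefficients a_{μνκ} with three different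
  indices are equal»), **`coeffA_diag_eq`** («all the coefficients a_{μμν} with μ ≠ ν are equal»), `coeffB_eq_of_perm`
  («the same conclusions hold for b»), via Mathlib's `Equiv.Perm.exists_extending_pair`.
* §4 the paper's instances: `cov527_gRep` (from (5.12), `B12Rep526Coeff.eq527`) and `cov527_f529` ((5.18), `eq518`), hence
  `eq531_gRep`, `eq532_gRep_a`, `eq532_gRep_b`, `coeffA_gRep_eq_of_distinct`.
No `Prop` placeholder beyond the covariance predicate `Cov527` (a hypothesis shape, discharged in §4); axioms standard.
-/

namespace Literature.MathematicalPhysics.QuantumFieldTheory.Balaban1983to89.B12Eq531Symmetry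

noncomputable section

open Literature.MathematicalPhysics.QuantumFieldTheory.GawedzkiKupiainen1985.PeriodicGleason (Pt)
open Literature.MathematicalPhysics.QuantumFieldTheory.Balaban1983to89.B12Rep526 (permZ permZ_apply)
open Literature.MathematicalPhysics.QuantumFieldTheory.Balaban1983to89.B12Rep526Coeff (gRep f529 Perm512 eq527 eq518)
open Literature.MathematicalPhysics.QuantumFieldTheory.Balaban1983to89.B12Momentum511 (pderiv)

variable {d : ℕ}

/-! ## §1. (5.27) for a family, and the coordinate-line bookkeeping -/

/-- **(5.27)** as a property of a family `g_{μν}` of functions on `ℂ^d`: `g_{μν}(rz) = ((r⊗r)g)_{μν}(z) = g_{r⁻¹μ,r⁻¹ν}(z)` for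
every permutation `r` of the axes (`(rz)_μ = z_{r⁻¹μ}`). [cite: Balaban1987RG1, (5.27) p.295] -/
def Cov527 (g : Fin d → Fin d → (Fin d → ℂ) → ℂ) : Prop :=
  ∀ (r : Equiv.Perm (Fin d)) (μ ν : Fin d) (z : Fin d → ℂ), g μ ν (permZ r z) = g (r.symm μ) (r.symm ν) z

/-- `r(r⁻¹z) = z`. [cite: Balaban1987RG1, (5.27) p.295] -/
theorem permZ_permZ_symm (r : Equiv.Perm (Fin d)) (z : Fin d → ℂ) : permZ r (permZ r.symm z) = z := by
  funext μ; simp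

/-- `r⁻¹(rz) = z`. [cite: Balaban1987RG1, (5.27) p.295] -/
theorem permZ_symm_permZ (r : Equiv.Perm (Fin d)) (z : Fin d → ℂ) : permZ r.symm (permZ r z) = z := by
  funext μ; simp

/-- `r⁻¹1 = 1` (the base point of (5.30) is fixed by every permutation). [cite: Balaban1987RG1, (5.30) p.295] -/
theorem permZ_one (r : Equiv.Perm (Fin d)) : permZ r (fun _ : Fin d => (1 : ℂ)) = fun _ => 1 := by
  funext μ; simp

/-- A coordinate line is carried to a coordinate line: `r⁻¹(z + te_ρ) = r⁻¹z + te_{r⁻¹ρ}`.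
[cite: Balaban1987RG1, (5.31) p.295] -/
theorem permZ_add_smul_single (r : Equiv.Perm (Fin d)) (z : Fin d → ℂ) (t : ℂ) (ρ : Fin d) :
    permZ r.symm (z + t • Pi.single ρ (1 : ℂ)) = permZ r.symm z + t • Pi.single (r.symm ρ) 1 := by
  funext μ
  simp only [permZ_apply, Equiv.symm_symm, Pi.add_apply, Pi.smul_apply, Pi.single_apply,
    Equiv.apply_eq_iff_eq_symm_apply]

/-- **The core of (5.31).**  If `F(rw) = G(w)` for all `w`, then `(∂_ρF)(z) = (∂_{r⁻¹ρ}G)(r⁻¹z)` at every `z` — an identity of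
the one-variable functions `t ↦ F(z + te_ρ) = G(r⁻¹z + te_{r⁻¹ρ})`, so no differentiability is needed.
[cite: Balaban1987RG1, (5.31) p.295] -/
theorem pderiv_of_permCov {F G : (Fin d → ℂ) → ℂ} (r : Equiv.Perm (Fin d)) (h : ∀ w, F (permZ r w) = G w)
    (ρ : Fin d) (z : Fin d → ℂ) : pderiv ρ F z = pderiv (r.symm ρ) G (permZ r.symm z) := by
  unfold pderiv
  congr 1
  funext t
  rw [← h, ← permZ_add_smul_single, permZ_permZ_symm]

/-! ## §2. (5.31): «(∂/∂z_ρ g_{μν})(z) = Σ_{κ,λ,σ} r_{μκ}r_{νλ}r_{ρσ}(∂/∂z_σ g_{κλ})(r⁻¹z) for all permutations r, identically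
for higher order derivatives» -/

/-- **(5.31)**: `(∂_ρg_{μν})(z) = (∂_{r⁻¹ρ}g_{r⁻¹μ,r⁻¹ν})(r⁻¹z)` for every permutation `r` and EVERY `z ∈ ℂ^d`.
[cite: Balaban1987RG1, (5.31) p.295] -/
theorem eq531 {g : Fin d → Fin d → (Fin d → ℂ) → ℂ} (hg : Cov527 g) (r : Equiv.Perm (Fin d)) (μ ν ρ : Fin d)
    (z : Fin d → ℂ) :
    pderiv ρ (g μ ν) z = pderiv (r.symm ρ) (g (r.symm μ) (r.symm ν)) (permZ r.symm z) :=
  pderiv_of_permCov r (fun w => hg r μ ν w) ρ z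

/-- **(5.31), «identically for higher order derivatives»** — second order:
`(∂_κ∂_ρg_{μν})(z) = (∂_{r⁻¹κ}∂_{r⁻¹ρ}g_{r⁻¹μ,r⁻¹ν})(r⁻¹z)`. [cite: Balaban1987RG1, (5.31) p.295] -/
theorem eq531_order2 {g : Fin d → Fin d → (Fin d → ℂ) → ℂ} (hg : Cov527 g) (r : Equiv.Perm (Fin d))
    (μ ν κ ρ : Fin d) (z : Fin d → ℂ) :
    pderiv κ (pderiv ρ (g μ ν)) z
      = pderiv (r.symm κ) (pderiv (r.symm ρ) (g (r.symm μ) (r.symm ν))) (permZ r.symm z) :=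
  pderiv_of_permCov r (fun w => by rw [eq531 hg r μ ν ρ, permZ_symm_permZ]) κ z

/-- **(5.31)**, third order (the derivatives in the remainder of (5.30)):
`(∂_λ∂_κ∂_ρg_{μν})(z) = (∂_{r⁻¹λ}∂_{r⁻¹κ}∂_{r⁻¹ρ}g_{r⁻¹μ,r⁻¹ν})(r⁻¹z)`. [cite: Balaban1987RG1, (5.31) p.295] -/
theorem eq531_order3 {g : Fin d → Fin d → (Fin d → ℂ) → ℂ} (hg : Cov527 g) (r : Equiv.Perm (Fin d))
    (μ ν l κ ρ : Fin d) (z : Fin d → ℂ) :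
    pderiv l (pderiv κ (pderiv ρ (g μ ν))) z
      = pderiv (r.symm l) (pderiv (r.symm κ) (pderiv (r.symm ρ) (g (r.symm μ) (r.symm ν)))) (permZ r.symm z) :=
  pderiv_of_permCov r (fun w => by rw [eq531_order2 hg r μ ν κ ρ, permZ_symm_permZ]) l z

/-! ## §3. (5.32): the Taylor coefficients at `z = 1` -/

/-- `a_{μν,κ} := (∂g_{μν}/∂z_κ)(1)`, the first-order Taylor coefficients of (5.30). [cite: Balaban1987RG1, (5.30) p.295] -/
def coeffA (g : Fin d → Fin d → (Fin d → ℂ) → ℂ) (μ ν κ : Fin d) : ℂ := pderiv κ (g μ ν) fun _ => 1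

/-- `b_{μν,κλ} := (∂²g_{μν}/∂z_κ∂z_λ)(1)`, the second-order Taylor coefficients of (5.30).
[cite: Balaban1987RG1, (5.30) p.295] -/
def coeffB (g : Fin d → Fin d → (Fin d → ℂ) → ℂ) (μ ν κ l : Fin d) : ℂ := pderiv κ (pderiv l (g μ ν)) fun _ => 1

/-- **(5.32) for `a`**: `a_{μν,ρ} = Σ r_{μκ}r_{νλ}r_{ρσ}a_{κλ,σ} = a_{r⁻¹μ r⁻¹ν, r⁻¹ρ}` for every permutation `r`.
[cite: Balaban1987RG1, (5.32) p.296] -/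
theorem eq532_a {g : Fin d → Fin d → (Fin d → ℂ) → ℂ} (hg : Cov527 g) (r : Equiv.Perm (Fin d)) (μ ν ρ : Fin d) :
    coeffA g μ ν ρ = coeffA g (r.symm μ) (r.symm ν) (r.symm ρ) := by
  unfold coeffA
  rw [eq531 hg r μ ν ρ, permZ_one]

/-- **(5.32), «the same for b_{μν,κλ}»**: `b_{μν,κλ} = b_{r⁻¹μ r⁻¹ν, r⁻¹κ r⁻¹λ}` for every permutation `r`.
[cite: Balaban1987RG1, (5.32) p.296] -/
theorem eq532_b {g : Fin d → Fin d → (Fin d → ℂ) → ℂ} (hg : Cov527 g) (r : Equiv.Perm (Fin d))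
    (μ ν κ l : Fin d) : coeffB g μ ν κ l = coeffB g (r.symm μ) (r.symm ν) (r.symm κ) (r.symm l) := by
  unfold coeffB
  rw [eq531_order2 hg r μ ν κ l, permZ_one]

/-- Three pairwise different indices form an injective triple. [folklore] -/
private theorem injective_triple {μ ν κ : Fin d} (h₁ : μ ≠ ν) (h₂ : μ ≠ κ) (h₃ : ν ≠ κ) :
    Function.Injective ![μ, ν, κ] := by
  intro i j hij
  fin_cases i <;> fin_cases j <;> simp_all [eq_comm]

/-- Two different indices form an injective pair. [folklore] -/
private theorem injective_pair {μ ν : Fin d} (h : μ ≠ ν) : Function.Injective ![μ, ν] := by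
  intro i j hij
  fin_cases i <;> fin_cases j <;> simp_all [eq_comm]

/-- **«This implies that all the coefficients a_{μνκ} with three different indices are equal»**: for pairwise different
`μ, ν, κ` and pairwise different `μ′, ν′, κ′`, `a_{μν,κ} = a_{μ′ν′,κ′}` (a permutation carrying one triple to the other exists:
Mathlib's `Equiv.Perm.exists_extending_pair`). [cite: Balaban1987RG1, (5.32) p.296] -/
theorem coeffA_eq_of_distinct {g : Fin d → Fin d → (Fin d → ℂ) → ℂ} (hg : Cov527 g) {μ ν κ μ' ν' κ' : Fin d}
    (h₁ : μ ≠ ν) (h₂ : μ ≠ κ) (h₃ : ν ≠ κ) (h₁' : μ' ≠ ν') (h₂' : μ' ≠ κ') (h₃' : ν' ≠ κ') :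
    coeffA g μ ν κ = coeffA g μ' ν' κ' := by
  obtain ⟨σ, hσ⟩ := Equiv.Perm.exists_extending_pair ![μ', ν', κ'] ![μ, ν, κ]
    (injective_triple h₁' h₂' h₃') (injective_triple h₁ h₂ h₃)
  have e0 : σ.symm μ = μ' := by rw [Equiv.symm_apply_eq]; exact (hσ 0).symm
  have e1 : σ.symm ν = ν' := by rw [Equiv.symm_apply_eq]; exact (hσ 1).symm
  have e2 : σ.symm κ = κ' := by rw [Equiv.symm_apply_eq]; exact (hσ 2).symm
  rw [eq532_a hg σ μ ν κ, e0, e1, e2]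

/-- **«similarly all the coefficients a_{μμν} with μ ≠ ν are equal»**: `a_{μμ,ν} = a_{μ′μ′,ν′}` for `μ ≠ ν`, `μ′ ≠ ν′`.
[cite: Balaban1987RG1, (5.32) p.296] -/
theorem coeffA_diag_eq {g : Fin d → Fin d → (Fin d → ℂ) → ℂ} (hg : Cov527 g) {μ ν μ' ν' : Fin d} (h : μ ≠ ν)
    (h' : μ' ≠ ν') : coeffA g μ μ ν = coeffA g μ' μ' ν' := by
  obtain ⟨σ, hσ⟩ := Equiv.Perm.exists_extending_pair ![μ', ν'] ![μ, ν] (injective_pair h') (injective_pair h)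
  have e0 : σ.symm μ = μ' := by rw [Equiv.symm_apply_eq]; exact (hσ 0).symm
  have e1 : σ.symm ν = ν' := by rw [Equiv.symm_apply_eq]; exact (hσ 1).symm
  rw [eq532_a hg σ μ μ ν, e0, e1]

/-- «and so on»: the mixed pattern `a_{μν,μ} = a_{μ′ν′,μ′}` for `μ ≠ ν`, `μ′ ≠ ν′`. [cite: Balaban1987RG1, (5.32) p.296] -/
theorem coeffA_mixed_eq {g : Fin d → Fin d → (Fin d → ℂ) → ℂ} (hg : Cov527 g) {μ ν μ' ν' : Fin d} (h : μ ≠ ν)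
    (h' : μ' ≠ ν') : coeffA g μ ν μ = coeffA g μ' ν' μ' := by
  obtain ⟨σ, hσ⟩ := Equiv.Perm.exists_extending_pair ![μ', ν'] ![μ, ν] (injective_pair h') (injective_pair h)
  have e0 : σ.symm μ = μ' := by rw [Equiv.symm_apply_eq]; exact (hσ 0).symm
  have e1 : σ.symm ν = ν' := by rw [Equiv.symm_apply_eq]; exact (hσ 1).symm
  rw [eq532_a hg σ μ ν μ, e0, e1]

/-- **«The same conclusions hold for b_{μνκλ}»** — the general statement: index quadruples related by a permutation carry equal
coefficients, `b_{σμ σν, σκ σλ} = b_{μν,κλ}`. [cite: Balaban1987RG1, (5.32) p.296] -/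
theorem coeffB_eq_of_perm {g : Fin d → Fin d → (Fin d → ℂ) → ℂ} (hg : Cov527 g) (σ : Equiv.Perm (Fin d))
    (μ ν κ l : Fin d) : coeffB g (σ μ) (σ ν) (σ κ) (σ l) = coeffB g μ ν κ l := by
  rw [eq532_b hg σ (σ μ) (σ ν) (σ κ) (σ l)]
  simp

/-- The corresponding general statement for `a`: `a_{σμ σν, σκ} = a_{μν,κ}`. [cite: Balaban1987RG1, (5.32) p.296] -/
theorem coeffA_eq_of_perm {g : Fin d → Fin d → (Fin d → ℂ) → ℂ} (hg : Cov527 g) (σ : Equiv.Perm (Fin d))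
    (μ ν κ : Fin d) : coeffA g (σ μ) (σ ν) (σ κ) = coeffA g μ ν κ := by
  rw [eq532_a hg σ (σ μ) (σ ν) (σ κ)]
  simp

/-! ## §4. The paper's `g_{μν}` and `f_{μν}` -/

/-- The paper's `g_{μν}` = `B12Rep526Coeff.gRep c μ ν` satisfies (5.27) whenever the kernel family has the permutation
covariance (5.12) (`B12Rep526Coeff.eq527`). [cite: Balaban1987RG1, (5.27) p.295] -/
theorem cov527_gRep (c : Fin d → Fin d → Pt d → ℂ) (hP : Perm512 c) : Cov527 (gRep c) :=
  fun r μ ν z => eq527 c hP r μ ν z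

/-- `f_{μν}` = (5.29) satisfies (5.18) = the same covariance (`B12Rep526Coeff.eq518`). [cite: Balaban1987RG1, (5.18) p.294] -/
theorem cov527_f529 (c : Fin d → Fin d → Pt d → ℂ) (hP : Perm512 c) : Cov527 (f529 c) :=
  fun r μ ν z => eq518 c hP r μ ν z

/-- **(5.31) for the paper's `g_{μν}`**, from (5.12). [cite: Balaban1987RG1, (5.31) p.295] -/
theorem eq531_gRep (c : Fin d → Fin d → Pt d → ℂ) (hP : Perm512 c) (r : Equiv.Perm (Fin d)) (μ ν ρ : Fin d)
    (z : Fin d → ℂ) :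
    pderiv ρ (gRep c μ ν) z = pderiv (r.symm ρ) (gRep c (r.symm μ) (r.symm ν)) (permZ r.symm z) :=
  eq531 (cov527_gRep c hP) r μ ν ρ z

/-- **(5.32) for the paper's `a_{μν,κ}`**, from (5.12). [cite: Balaban1987RG1, (5.32) p.296] -/
theorem eq532_gRep_a (c : Fin d → Fin d → Pt d → ℂ) (hP : Perm512 c) (r : Equiv.Perm (Fin d)) (μ ν ρ : Fin d) :
    coeffA (gRep c) μ ν ρ = coeffA (gRep c) (r.symm μ) (r.symm ν) (r.symm ρ) :=
  eq532_a (cov527_gRep c hP) r μ ν ρ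

/-- **(5.32) for the paper's `b_{μν,κλ}`**, from (5.12). [cite: Balaban1987RG1, (5.32) p.296] -/
theorem eq532_gRep_b (c : Fin d → Fin d → Pt d → ℂ) (hP : Perm512 c) (r : Equiv.Perm (Fin d))
    (μ ν κ l : Fin d) :
    coeffB (gRep c) μ ν κ l = coeffB (gRep c) (r.symm μ) (r.symm ν) (r.symm κ) (r.symm l) :=
  eq532_b (cov527_gRep c hP) r μ ν κ l

/-- For the paper's `g_{μν}`: all `a_{μνκ}` with three different indices are equal. [cite: Balaban1987RG1, (5.32) p.296] -/
theorem coeffA_gRep_eq_of_distinct (c : Fin d → Fin d → Pt d → ℂ) (hP : Perm512 c) {μ ν κ μ' ν' κ' : Fin d}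
    (h₁ : μ ≠ ν) (h₂ : μ ≠ κ) (h₃ : ν ≠ κ) (h₁' : μ' ≠ ν') (h₂' : μ' ≠ κ') (h₃' : ν' ≠ κ') :
    coeffA (gRep c) μ ν κ = coeffA (gRep c) μ' ν' κ' :=
  coeffA_eq_of_distinct (cov527_gRep c hP) h₁ h₂ h₃ h₁' h₂' h₃'

end

end Literature.MathematicalPhysics.QuantumFieldTheory.Balaban1983to89.B12Eq531Symmetry
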